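import Mathlib.MeasureTheory.Constructions.Polish.Basic
import Mathlib.Topology.ContinuousMap.SecondCountableSpace
import Mathlib.Topology.UniformSpace.CompactConvergence
import Mathlib.Topology.MetricSpace.Polish
import Mathlib.Analysis.Complex.ReImTopology
import Mathlib.Analysis.Normed.Group.Bounded
import Literature.Probability.RandomPlanarGeometry.SLEProofs
import Literature.Probability.RandomPlanarGeometry.CaratheodoryHalfPlane
import Literature.Probability.RandomPlanarGeometry.ConformalMapRiemannProofs
import Literature.Probability.RandomPlanarGeometry.JordanDomainProofs
import HarnessLib

/-!
# Existence of the chordal SLE_κ random curve: reduction to named facts (trunk `Stoch`)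

This file reduces the named fact `Literature.Probability.RandomPlanarGeometry.exists_isSLECurve` of
`Literature.Probability.RandomPlanarGeometry.SLE` (existence, for `κ > 0` and every Dobrushin
domain `(D; a, b)`, of an a.e.-measurable random variable `Γ : (ℝ≥0 → ℝ) → CurveClass ℂ` which
is a.s. the class of the time-compactified image of the SLE_κ trace under the boundary extension
of a chordal uniformizing map `φ : ℍₒ → D`) to its deep inputs, which stay named facts:

* the Rohde–Schramm theorem (`Literature.Probability.RandomPlanarGeometry.hasSLETrace_of_ne_eight`, RS05 Thm 5.1) and its extension to
  `κ = 8` (`Literature.Probability.RandomPlanarGeometry.hasSLETrace_eight`, Lawler–Schramm–Werner 2004, Thm 4.7);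
* transience of the trace (`Literature.Probability.RandomPlanarGeometry.tendsto_norm_sleTrace_atTop`, RS05 Thm 7.1);
* existence of chordal uniformizing maps (`Literature.Probability.RandomPlanarGeometry.MarkedDomain.exists_isChordalUniformizing`,
  Riemann mapping theorem + Carathéodory) and continuity of the boundary extension on the
  closed half-plane (`Literature.Probability.RandomPlanarGeometry.JordanDomain.continuousOn_boundaryExtension`, Carathéodory);
* a.e.-measurability of the marginals `ω ↦ γ(t)` of the trace, taken as an explicit
  hypothesis (`Literature.Probability.RandomPlanarGeometry.exists_isSLECurve_of_aemeasurable`), vendored as the named fact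
  `Literature.Probability.RandomPlanarGeometry.aemeasurable_sleTrace` (RS05 §3 p. 896 with Thm 5.1;
  `Literature.Probability.RandomPlanarGeometry.exists_isSLECurve_of_aemeasurable_sleTrace`), or read off the named fact
  `Literature.Probability.RandomPlanarGeometry.identDistrib_sleTrace_scale` (SLE scaling in law, which asserts in particular that the
  trace is an a.e.-measurable random path; `Literature.Probability.RandomPlanarGeometry.exists_isSLECurve_of_facts`,
  `Literature.Probability.RandomPlanarGeometry.aemeasurable_sleTrace_of_identDistrib`).

Everything else — the topological glue (the compactified curve `s ↦ Φ(γ(s/(1-s)))`, `1 ↦ b`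
is continuous on `[0, 1]`: continuity of `Φ ∘ γ` on `[0, ∞)`, `Φ → b` at infinity *within the
closed half-plane*, `γ → ∞`) and the measurability glue (a random continuous curve whose
values at a countable dense set of parameters are measurable is a measurable random element of
`C([0,1], ℂ)`, hence of the curve space modulo reparametrisation; modification on a null set)
— is proved here. Finally `Literature.Probability.RandomPlanarGeometry.exists_isSLECurve_of_disc_facts` replaces the two half-plane
inputs by the printed disc-form theorems (Riemann mapping `Literature.Probability.RandomPlanarGeometry.exists_conformalEquiv_ball`,
Carathéodory `Literature.Probability.RandomPlanarGeometry.JordanDomain.exists_continuousOn_extension`) and simple connectivity of Jordan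
domains, using `Literature.Probability.RandomPlanarGeometry.CaratheodoryHalfPlane`; and
`Literature.Probability.RandomPlanarGeometry.exists_isSLECurve_of_trace_facts` discharges the last two of these by the *proved* Riemann
mapping theorem (`Literature.Probability.RandomPlanarGeometry.exists_conformalEquiv_ball_holds`,
`Literature.Probability.RandomPlanarGeometry.ConformalMapRiemannProofs`) and the *proved* simple
connectivity of Jordan domains (`Literature.Probability.RandomPlanarGeometry.JordanDomain.isSimplyConnected_holds`,
`Literature.Probability.RandomPlanarGeometry.JordanDomainProofs`, via Runge's theorem), leaving
`Literature.Probability.RandomPlanarGeometry.exists_isSLECurve` resting on the four SLE trace facts and Carathéodory's theorem only; and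
`Literature.Probability.RandomPlanarGeometry.exists_isSLECurve_of_closedBall_facts` further weakens Carathéodory's theorem to its
continuity part (`Literature.Probability.RandomPlanarGeometry.JordanDomain.exists_continuousOn_closedBall_extension`, Pommerenke Thm 2.1).

## Mathlib

We USE `Continuous.measurableEmbedding` (an injective continuous map from a Polish space is a
measurable embedding; applied to the restriction `C(I, ℂ) → (S → ℂ)` to a countable dense
`S ⊆ I`), `Measurable.dite`, `MeasureTheory.exists_measurable_superset_of_null`,
`Filter.hasBasis_cocompact`, `tendsto_norm_atTop_iff_cobounded`, `Metric.cobounded_eq_cocompact`,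
`tendsto_inv_nhdsGT_zero`, `Filter.Tendsto.pos_mul_atTop`, and the instances making `C(I, ℂ)` a
Polish space (`ContinuousMap.instSecondCountableTopology`,
`ContinuousMap.instCompleteSpaceOfCompactlyCoherentSpace`). The Borel σ-algebra on `C(I, ℂ)` is
introduced only locally inside proofs (`borel`), never as an instance. From
`Literature.Probability.RandomPlanarGeometry.SLEProofs` we use `Literature.Probability.RandomPlanarGeometry.nodeValue` (the compactified
image as a bare function), `Literature.Probability.RandomPlanarGeometry.continuous_curveMk` and
`Literature.Probability.RandomPlanarGeometry.ConformalEquiv.closure_upperHalfPlaneSet_eq`.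

## References

* S. Rohde, O. Schramm, *Basic properties of SLE*, Ann. of Math. 161 (2005), 883–924: notation
  `f_t = g_t⁻¹`, `f̂_t(z) = f_t(z + ξ(t))` (p. 887); §3, proof of Thm 3.6 (p. 896: "for every
  `s`, the map `f̂_s` is measurable with respect to the σ-field generated by `ξ(t)`, `t ∈ [0, s]`");
  Thm 4.1 (p. 898); Thm 5.1 (p. 899, continuity: a.s. `γ(t) = lim_{z → 0} f̂_t(z)` exists for all
  `t`, is continuous and generates the hulls; `κ = 8` by [LSW]); Thm 7.1 (p. 909, transience;
  `κ = 8` included by the Update, p. 911).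
* G. F. Lawler, O. Schramm, W. Werner, *Conformal invariance of planar loop-erased random walks
  and uniform spanning trees*, Ann. Probab. 32 (2004), Thm 4.7 (`κ = 8`).
* G. F. Lawler, *Conformally Invariant Processes in the Plane*, AMS (2005), §6.3 (chordal SLE in
  a simply connected domain as the conformal image of SLE in `ℍ`), Prop. 6.5 (scaling).
* A. S. Kechris, *Classical Descriptive Set Theory* (1995), Thm 15.1 (Lusin–Souslin).
-/

noncomputable section

open Set Filter Topology MeasureTheory Complex
open UpperHalfPlane (upperHalfPlaneSet isOpen_upperHalfPlaneSet)
open scoped NNReal unitInterval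

namespace Literature.Probability.RandomPlanarGeometry

/-! ### Topological glue -/

/-- The SLE trace always lies in the closed upper half-plane: it is either a generating curve
(`Loewner.IsGeneratedByCurve.im_nonneg`) or the junk constant real curve `W 0`. [folklore] -/
theorem Loewner.trace_im_nonneg (W : ℝ≥0 → ℝ) (t : ℝ≥0) : 0 ≤ (Loewner.trace W t).im := by
  by_cases h : ∃ γ, Loewner.IsGeneratedByCurve W γ
  · exact (Loewner.isGeneratedByCurve_trace h).im_nonneg t
  · rw [Loewner.trace, dif_neg h, ofReal_im]

/-- The SLE trace lies in the closed upper half-plane, for every `ω` and `t`. [folklore] -/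
theorem sleTrace_mem_closure (κ : ℝ≥0) (ω : ℝ≥0 → ℝ) (t : ℝ≥0) :
    sleTrace κ ω t ∈ closure upperHalfPlaneSet := by
  rw [ConformalEquiv.closure_upperHalfPlaneSet_eq]
  exact Loewner.trace_im_nonneg _ t

/-- **Boundary value at infinity of the boundary extension.** If `φ : U → V` has boundary value
`p` at infinity (limit along `cocompact ℂ ⊓ 𝓟 U`) and its boundary extension `Φ` is continuous
on `closure U`, then `Φ → p` at infinity *within `closure U`* as well: `Φ x` is the limit of `φ`
along `𝓝[U] x`, and far away from the origin these values are uniformly close to `p`.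
Pommerenke (1992), §2.1. [folklore] -/
theorem ConformalEquiv.tendsto_boundaryExtension_cocompact {U V : Set ℂ} (φ : ConformalEquiv U V)
    (hcont : ContinuousOn φ.boundaryExtension (closure U)) {p : ℂ}
    (h : φ.HasBoundaryValueAtInfty p) :
    Tendsto φ.boundaryExtension (cocompact ℂ ⊓ 𝓟 (closure U)) (𝓝 p) := by
  rw [Metric.tendsto_nhds]
  intro ε hε
  have h' : ∀ᶠ z in cocompact ℂ ⊓ 𝓟 U, dist (φ z) p < ε / 2 :=
    Metric.tendsto_nhds.1 h (ε / 2) (half_pos hε)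
  rw [(hasBasis_cocompact.inf_principal _).eventually_iff] at h' ⊢
  obtain ⟨K, hK, hKε⟩ := h'
  obtain ⟨R, hR⟩ := hK.isBounded.subset_closedBall 0
  refine ⟨Metric.closedBall 0 R, isCompact_closedBall 0 R, ?_⟩
  rintro x ⟨hxR, hxU⟩
  haveI : (𝓝[U] x).NeBot := mem_closure_iff_nhdsWithin_neBot.1 hxU
  -- `Φ x` is the limit of `φ` along `𝓝[U] x`
  have hx : Tendsto φ (𝓝[U] x) (𝓝 (φ.boundaryExtension x)) := by
    have h1 : Tendsto φ.boundaryExtension (𝓝[U] x) (𝓝 (φ.boundaryExtension x)) :=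
      (hcont x hxU).tendsto.mono_left (nhdsWithin_mono x subset_closure)
    exact h1.congr' (eventually_nhdsWithin_of_forall fun z hz ↦ φ.boundaryExtension_eq hz)
  -- near `x` (outside the closed ball) the values of `φ` on `U` are `ε/2`-close to `p`
  have hev : ∀ᶠ z in 𝓝[U] x, dist (φ z) p ≤ ε / 2 := by
    have hopen : (Metric.closedBall (0 : ℂ) R)ᶜ ∈ 𝓝 x :=
      Metric.isClosed_closedBall.isOpen_compl.mem_nhds hxR
    filter_upwards [inter_mem_nhdsWithin U hopen] with z hz
    exact (hKε ⟨fun hzK ↦ hz.2 (hR hzK), hz.1⟩).le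
  have hle : dist (φ.boundaryExtension x) p ≤ ε / 2 :=
    le_of_tendsto (hx.dist tendsto_const_nhds) hev
  exact hle.trans_lt (half_lt_self hε)

/-- A function with norm tending to infinity tends to the cocompact filter of `ℂ`
(`ℂ` is proper: `cocompact = cobounded`). [folklore] -/
theorem tendsto_cocompact_of_tendsto_norm_atTop {α : Type*} {l : Filter α} {f : α → ℂ}
    (h : Tendsto (fun t ↦ ‖f t‖) l atTop) : Tendsto f l (cocompact ℂ) := by
  rw [← Metric.cobounded_eq_cocompact]
  exact tendsto_norm_atTop_iff_cobounded.1 h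

/-- The ray parametrisation `s ↦ s / (1 - s)` tends to `+∞` as `s → 1⁻` in `[0, 1]`. [folklore] -/
theorem tendsto_rayParam_atTop : Tendsto rayParam (𝓝[{s : I | (s : ℝ) < 1}] 1) atTop := by
  rw [← NNReal.tendsto_coe_atTop]
  have h1 : Tendsto (fun s : I ↦ (s : ℝ)) (𝓝[{s : I | (s : ℝ) < 1}] 1) (𝓝 1) := by
    have : Tendsto (fun s : I ↦ (s : ℝ)) (𝓝 (1 : I)) (𝓝 ((1 : I) : ℝ)) :=
      continuous_subtype_val.tendsto (1 : I)
    exact this.mono_left nhdsWithin_le_nhds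
  have h2 : Tendsto (fun s : I ↦ 1 - (s : ℝ)) (𝓝[{s : I | (s : ℝ) < 1}] 1) (𝓝[>] 0) := by
    refine tendsto_nhdsWithin_iff.2 ⟨?_, ?_⟩
    · simpa using (tendsto_const_nhds (x := (1 : ℝ))).sub h1
    · exact eventually_nhdsWithin_of_forall fun s hs ↦ mem_Ioi.2 (sub_pos.2 hs)
  have h3 : Tendsto (fun s : I ↦ (s : ℝ) * (1 - (s : ℝ))⁻¹) (𝓝[{s : I | (s : ℝ) < 1}] 1) atTop :=
    h1.pos_mul_atTop one_pos (tendsto_inv_nhdsGT_zero.comp h2)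
  refine h3.congr fun s ↦ ?_
  rw [coe_rayParam, div_eq_mul_inv]

/-- The ray parametrisation is continuous on `[0, 1)`. [folklore] -/
theorem continuousAt_rayParam {s : I} (hs : (s : ℝ) < 1) : ContinuousAt rayParam s := by
  have h : ContinuousAt (fun s : I ↦ (s : ℝ) / (1 - s)) s :=
    continuous_subtype_val.continuousAt.div
      (continuousAt_const.sub continuous_subtype_val.continuousAt) (sub_ne_zero.2 (ne_of_gt hs))
  rw [ContinuousAt, ← NNReal.tendsto_coe]
  simpa only [coe_rayParam] using h.tendsto

/-- Value of the compactified image `nodeValue Φ b γ` before time `1`. [folklore] -/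
theorem nodeValue_of_lt (Φ : ℂ → ℂ) (b : ℂ) (γ : ℝ≥0 → ℂ) {s : I} (hs : (s : ℝ) < 1) :
    nodeValue Φ b γ s = Φ (γ (rayParam s)) :=
  if_pos hs

/-- Value of the compactified image `nodeValue Φ b γ` at time `1`. [folklore] -/
@[simp]
theorem nodeValue_one (Φ : ℂ → ℂ) (b : ℂ) (γ : ℝ≥0 → ℂ) : nodeValue Φ b γ 1 = b :=
  if_neg (lt_irrefl _)

/-- **Continuity of the compactified image.** If `Φ` is continuous on a set `A` and tends to `b`
at infinity within `A`, and `γ : [0, ∞) → A` is continuous and tends to infinity, then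
`s ↦ Φ (γ (s / (1 - s)))`, `1 ↦ b` (`nodeValue Φ b γ`) is a continuous curve on `[0, 1]`. This
is the deterministic content of "chordal SLE in `(D; a, b)` is a curve from `a` to `b`" (with
`A` the closed half-plane, `Φ` the boundary extension of the uniformizing map, `γ` the transient
trace). Lawler (2005), §6.3. [folklore] -/
theorem continuous_nodeValue {A : Set ℂ} {Φ : ℂ → ℂ} {γ : ℝ≥0 → ℂ} {b : ℂ}
    (hΦ : ContinuousOn Φ A) (hΦinf : Tendsto Φ (cocompact ℂ ⊓ 𝓟 A) (𝓝 b)) (hγ : Continuous γ)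
    (hγA : ∀ t, γ t ∈ A) (hγinf : Tendsto γ atTop (cocompact ℂ)) :
    Continuous (nodeValue Φ b γ) := by
  have hc : Continuous fun t ↦ Φ (γ t) := hΦ.comp_continuous hγ hγA
  rw [continuous_iff_continuousAt]
  intro s
  by_cases hs : (s : ℝ) < 1
  · -- before time `1` the function is locally `Φ ∘ γ ∘ rayParam`
    have hopen : IsOpen {s : I | (s : ℝ) < 1} := isOpen_lt continuous_subtype_val continuous_const
    have hev : (fun s ↦ Φ (γ (rayParam s))) =ᶠ[𝓝 s] nodeValue Φ b γ :=
      eventually_of_mem (hopen.mem_nhds hs) fun s' hs' ↦ (nodeValue_of_lt Φ b γ hs').symm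
    exact (hc.continuousAt.comp (continuousAt_rayParam hs)).congr hev
  · -- at time `1`: `γ → ∞` within `A`, where `Φ → b`
    obtain rfl : s = 1 := Subtype.ext (le_antisymm s.2.2 (not_lt.1 hs))
    have hcover : ({s : I | (s : ℝ) < 1} ∪ {1} : Set I) = univ := by
      refine eq_univ_of_forall fun s ↦ ?_
      rcases lt_or_eq_of_le s.2.2 with h | h
      · exact Or.inl h
      · exact Or.inr (Subtype.ext h)
    rw [← continuousWithinAt_univ, ← hcover, continuousWithinAt_union]
    refine ⟨?_, continuousWithinAt_singleton⟩
    change Tendsto _ _ (𝓝 (nodeValue Φ b γ 1))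
    rw [nodeValue_one]
    have hγ' : Tendsto γ atTop (cocompact ℂ ⊓ 𝓟 A) :=
      tendsto_inf.2 ⟨hγinf, tendsto_principal.2 (Eventually.of_forall hγA)⟩
    refine ((hΦinf.comp hγ').comp tendsto_rayParam_atTop).congr' ?_
    exact eventually_nhdsWithin_of_forall fun s hs ↦ (nodeValue_of_lt Φ b γ hs).symm

/-! ### Measurability glue -/

/-- **Measurability criterion for random curves.** A family `F ω : [0, 1] → ℂ` of continuous
curves whose evaluations at the points of a countable dense set `S ⊆ [0, 1]` are measurable in
`ω` defines a measurable random element `ω ↦ [F ω]` of the space of curves modulo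
reparametrisation. Proof: restriction to `S` is an injective (density) continuous map from the
Polish space `C([0,1], ℂ)` to the Polish space `S → ℂ`, hence a measurable embedding
(Lusin–Souslin, `Continuous.measurableEmbedding`), so `ω ↦ F ω ∈ C([0,1], ℂ)` is Borel
measurable; and `C([0,1], ℂ) → Curve ℂ → CurveClass ℂ` is continuous (`continuous_curveMk`).
Kechris, *Classical Descriptive Set Theory* (1995), Thm 15.1; Aizenman–Burchard (1999), §2.1. [folklore] -/
theorem measurable_curveClassMk {Ω : Type*} [MeasurableSpace Ω] {F : Ω → I → ℂ}
    (hF : ∀ ω, Continuous (F ω)) {S : Set I} (hSc : S.Countable) (hSd : Dense S)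
    (hmeas : ∀ s ∈ S, Measurable fun ω ↦ F ω s) :
    Measurable fun ω ↦ CurveClass.mk (⟨⟨F ω, hF ω⟩⟩ : Curve ℂ) := by
  letI : MeasurableSpace C(I, ℂ) := borel _
  haveI : BorelSpace C(I, ℂ) := ⟨rfl⟩
  -- `C(I, ℂ) → CurveClass ℂ` is continuous
  have hcont : Continuous fun f : C(I, ℂ) ↦ CurveClass.mk (⟨f⟩ : Curve ℂ) :=
    CurveClass.continuous_mk.comp continuous_curveMk
  suffices h : Measurable fun ω ↦ (⟨F ω, hF ω⟩ : C(I, ℂ)) from hcont.measurable.comp h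
  -- restriction to the countable dense set `S` is a measurable embedding into `S → ℂ`
  haveI : Countable S := hSc.to_subtype
  let e : C(I, ℂ) → (S → ℂ) := fun f s ↦ f s
  have he : MeasurableEmbedding e := by
    refine Continuous.measurableEmbedding (continuous_pi fun s ↦ ?_) fun f g hfg ↦ ?_
    · exact continuous_eval_const (s : I)
    · refine ContinuousMap.coe_injective (Continuous.ext_on hSd f.continuous g.continuous ?_)
      exact fun s hs ↦ congr_fun hfg ⟨s, hs⟩
  refine he.measurable_comp_iff.1 ?_
  exact measurable_pi_lambda _ fun s ↦ hmeas s s.2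

/-! ### The reduction -/

/-- **Existence of chordal SLE_κ in a Dobrushin domain, from marginal measurability of the
trace.** `Literature.Probability.RandomPlanarGeometry.exists_isSLECurve` follows from: SLE_κ is generated by a curve
(`hasSLETrace_eight`, `hasSLETrace_of_ne_eight`; Rohde–Schramm 2005 Thm 5.1,
Lawler–Schramm–Werner 2004 Thm 4.7), transience of the trace (`tendsto_norm_sleTrace_atTop`;
RS05 Thm 7.1), existence of a chordal uniformizing map `φ : ℍₒ → D` with `0 ↦ a`, `∞ ↦ b`
(`MarkedDomain.exists_isChordalUniformizing`; Riemann mapping + Carathéodory), continuity of its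
boundary extension `Φ` on the closed half-plane (`JordanDomain.continuousOn_boundaryExtension`;
Carathéodory), and a.e.-measurability of the trace marginals `ω ↦ γ(t)` whenever the trace
exists (hypothesis `hmeas`; RS05 §3, p. 896: `f̂_s` is `σ(ξ(u), u ≤ s)`-measurable, and Thm 5.1:
`γ(t) = lim_{z → 0} f̂_t(z)`). Construction: on a measurable set of full measure where the chain
is generated by the trace `γ`, `γ` is transient and `γ` agrees at the (countably many)
compactified rational times with measurable modifications, `Γ ω` is the class of the continuous
curve `s ↦ Φ(γ(s/(1-s)))`, `1 ↦ b` (`continuous_nodeValue`, using `Φ → b` at infinity within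
the closed half-plane, `ConformalEquiv.tendsto_boundaryExtension_cocompact`); elsewhere the
constant curve at `b`. Measurability by `measurable_curveClassMk`.
Lawler (2005), §6.3; Rohde–Schramm (2005), Thm 5.1 and Thm 7.1. [cite: RohdeSchramm2005, Thm 5.1 and Thm 7.1] -/
theorem exists_isSLECurve_of_aemeasurable (h8 : hasSLETrace_eight)
    (hne : hasSLETrace_of_ne_eight) (htr : tendsto_norm_sleTrace_atTop)
    (hunif : MarkedDomain.exists_isChordalUniformizing)
    (hext : JordanDomain.continuousOn_boundaryExtension)
    (hmeas : ∀ {κ : ℝ≥0}, HasSLETrace κ →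
      ∀ t : ℝ≥0, AEMeasurable (fun ω ↦ sleTrace κ ω t) Process.preWienerMeasure) :
    exists_isSLECurve := by
  intro κ hκ D
  classical
  -- the inputs
  have hκt : HasSLETrace κ := hasSLETrace h8 hne κ
  obtain ⟨φ, hφ⟩ := hunif D
  set Φ : ℂ → ℂ := φ.boundaryExtension with hΦdef
  set b : ℂ := D.pt 1 with hbdef
  have hΦcont : ContinuousOn Φ (closure upperHalfPlaneSet) := hext D.toJordanDomain φ
  have hΦinf : Tendsto Φ (cocompact ℂ ⊓ 𝓟 (closure upperHalfPlaneSet)) (𝓝 b) :=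
    φ.tendsto_boundaryExtension_cocompact hΦcont hφ.2
  set γ : (ℝ≥0 → ℝ) → ℝ≥0 → ℂ := fun ω ↦ sleTrace κ ω with hγdef
  -- a countable dense set of parameters and measurable modifications of the marginals there
  obtain ⟨S, hSc, hSd⟩ := TopologicalSpace.exists_countable_dense I
  haveI : Countable S := hSc.to_subtype
  have hm : ∀ s : S, AEMeasurable (fun ω ↦ γ ω (rayParam s)) Process.preWienerMeasure :=
    fun s ↦ hmeas hκt (rayParam s)
  set g : S → (ℝ≥0 → ℝ) → ℂ := fun s ↦ (hm s).mk _ with hgdef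
  have hgm : ∀ s, Measurable (g s) := fun s ↦ (hm s).measurable_mk
  -- the good event, of full measure
  set G : Set (ℝ≥0 → ℝ) := {ω | Loewner.IsGeneratedByCurve (sleDriving κ ω) (γ ω) ∧
    Tendsto (fun t ↦ ‖γ ω t‖) atTop atTop ∧ ∀ s : S, γ ω (rayParam s) = g s ω} with hGdef
  have hG : ∀ᵐ ω ∂Process.preWienerMeasure, ω ∈ G := by
    have h3 : ∀ᵐ ω ∂Process.preWienerMeasure, ∀ s : S, γ ω (rayParam s) = g s ω :=
      ae_all_iff.2 fun s ↦ (hm s).ae_eq_mk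
    filter_upwards [ae_isGeneratedByCurve_sleTrace hκt, htr hκ, h3] with ω h1 h2 h3
    exact ⟨h1, h2, h3⟩
  obtain ⟨N, hGN, hNm, hN0⟩ := exists_measurable_superset_of_null (ae_iff.1 hG)
  have hgood : ∀ ω, ω ∈ Nᶜ → ω ∈ G := fun ω hω ↦ by
    by_contra hωG
    exact hω (hGN hωG)
  have hae : ∀ᵐ ω ∂Process.preWienerMeasure, ω ∈ Nᶜ := measure_eq_zero_iff_ae_notMem.1 hN0
  -- the curve on the good event
  have hcurve : ∀ ω, ω ∈ Nᶜ → Continuous (nodeValue Φ b (γ ω)) := fun ω hω ↦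
    continuous_nodeValue hΦcont hΦinf (hgood ω hω).1.continuous
      (fun t ↦ sleTrace_mem_closure κ ω t) (tendsto_cocompact_of_tendsto_norm_atTop (hgood ω hω).2.1)
  set f : (Nᶜ : Set (ℝ≥0 → ℝ)) → CurveClass ℂ :=
    fun ω ↦ CurveClass.mk ⟨⟨nodeValue Φ b (γ ω), hcurve ω ω.2⟩⟩ with hfdef
  -- measurability of `f` on the good event
  have hf : Measurable f := by
    refine measurable_curveClassMk (fun ω : (Nᶜ : Set (ℝ≥0 → ℝ)) ↦ hcurve ω ω.2) hSc hSd ?_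
    intro s hs
    by_cases hs1 : (s : ℝ) < 1
    · -- `ω ↦ Φ (γ ω (rayParam s)) = Φ (g s ω)`, and `Φ` is continuous on the closed half-plane
      have hΦr : Continuous ((closure upperHalfPlaneSet).restrict Φ) :=
        continuousOn_iff_continuous_restrict.1 hΦcont
      have hgs : Measurable fun ω : (Nᶜ : Set (ℝ≥0 → ℝ)) ↦
          (⟨γ ω (rayParam s), sleTrace_mem_closure κ ω _⟩ : closure upperHalfPlaneSet) := by
        refine Measurable.subtype_mk ?_
        have heq : (fun ω : (Nᶜ : Set (ℝ≥0 → ℝ)) ↦ γ ω (rayParam s)) =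
            fun ω : (Nᶜ : Set (ℝ≥0 → ℝ)) ↦ g ⟨s, hs⟩ ω :=
          funext fun ω ↦ (hgood ω ω.2).2.2 ⟨s, hs⟩
        rw [heq]
        exact (hgm ⟨s, hs⟩).comp measurable_subtype_coe
      have heq : (fun ω : (Nᶜ : Set (ℝ≥0 → ℝ)) ↦ nodeValue Φ b (γ ω) s) =
          fun ω : (Nᶜ : Set (ℝ≥0 → ℝ)) ↦ (closure upperHalfPlaneSet).restrict Φ
            ⟨γ ω (rayParam s), sleTrace_mem_closure κ ω _⟩ :=
        funext fun ω ↦ nodeValue_of_lt Φ b (γ ω) hs1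
      rw [heq]
      exact hΦr.measurable.comp hgs
    · obtain rfl : s = 1 := Subtype.ext (le_antisymm s.2.2 (not_lt.1 hs1))
      simp only [nodeValue_one]
      exact measurable_const
  -- the random curve
  refine ⟨fun ω ↦ if hω : ω ∈ Nᶜ then f ⟨ω, hω⟩ else CurveClass.mk (Curve.const b), ?_, φ, hφ, ?_⟩
  · exact (Measurable.dite hf measurable_const hNm.compl).aemeasurable
  · filter_upwards [hae] with ω hω
    refine ⟨(hgood ω hω).1, ⟨⟨nodeValue Φ b (γ ω), hcurve ω hω⟩⟩, ?_, ?_, ?_⟩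
    · simp only [dif_pos hω, hfdef]
    · intro s hs
      exact nodeValue_of_lt Φ b (γ ω) hs
    · exact nodeValue_one Φ b (γ ω)

/-- The named fact `identDistrib_sleTrace_scale` (SLE scaling in law, stated as an identity of
laws on the path space `ℝ≥0 → ℂ` with the product σ-algebra) asserts in particular that the
trace `ω ↦ sleTrace κ ω` is an a.e.-measurable random path; hence every marginal
`ω ↦ sleTrace κ ω t` is a.e.-measurable. Rohde–Schramm (2005), §3 (p. 896) and Prop. 2.1 (i);
Lawler (2005), Prop. 6.5. [cite: RohdeSchramm2005, §3 p. 896] -/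
theorem aemeasurable_sleTrace_apply_of_identDistrib (h₅ : identDistrib_sleTrace_scale)
    (κ : ℝ≥0) (t : ℝ≥0) : AEMeasurable (fun ω ↦ sleTrace κ ω t) Process.preWienerMeasure :=
  (measurable_pi_apply t).comp_aemeasurable (h₅ κ one_ne_zero).aemeasurable_fst

/-- **Existence of chordal SLE_κ in a Dobrushin domain, reduced to named facts**:
`Literature.Probability.RandomPlanarGeometry.exists_isSLECurve` follows from the Rohde–Schramm theorem and its `κ = 8` complement
(`hasSLETrace_of_ne_eight`, RS05 Thm 5.1; `hasSLETrace_eight`, LSW04 Thm 4.7), transience of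
the trace (`tendsto_norm_sleTrace_atTop`, RS05 Thm 7.1), existence of chordal uniformizing maps
and Carathéodory continuity of their boundary extensions
(`MarkedDomain.exists_isChordalUniformizing`, `JordanDomain.continuousOn_boundaryExtension`;
Pommerenke (1992), Thm 2.6), and SLE scaling in law (`identDistrib_sleTrace_scale`, Lawler
(2005), Prop. 6.5), of which only the a.e.-measurability of the trace is used
(`exists_isSLECurve_of_aemeasurable`). Lawler (2005), §6.3; Rohde–Schramm (2005), Thm 5.1 and
Thm 7.1. [cite: RohdeSchramm2005, Thm 5.1 and Thm 7.1] -/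
theorem exists_isSLECurve_of_facts (h8 : hasSLETrace_eight) (hne : hasSLETrace_of_ne_eight)
    (htr : tendsto_norm_sleTrace_atTop) (hunif : MarkedDomain.exists_isChordalUniformizing)
    (hext : JordanDomain.continuousOn_boundaryExtension) (h₅ : identDistrib_sleTrace_scale) :
    exists_isSLECurve :=
  exists_isSLECurve_of_aemeasurable h8 hne htr hunif hext
    fun {κ} _ t ↦ aemeasurable_sleTrace_apply_of_identDistrib h₅ κ t

/-! ### The named fact: measurability of the trace marginals -/

/-- **Measurability of the SLE trace (marginals).** If SLE_κ is a.s. generated by a curve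
(`HasSLETrace κ`), then for every time `t` the position `γ(t) = sleTrace κ ω t` of the trace is
an a.e.-measurable function of the Brownian path `ω` (canonical space `ℝ≥0 → ℝ` with the product
σ-algebra and the pre-Wiener measure). Source: for every `s`, `f̂_s = g_s⁻¹(· + ξ(s))` is
measurable with respect to the σ-field generated by `ξ(u)`, `u ∈ [0, s]` (Rohde–Schramm 2005,
§3, proof of Thm 3.6, p. 896), and almost surely `γ(t) = lim_{z → 0, z ∈ ℍ} f̂_t(z)` for all `t`
(RS05 Thm 5.1, p. 899, `κ ≠ 8`; `κ = 8` by Lawler–Schramm–Werner 2004, Thm 4.7, cf. the Update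
p. 911), so `γ(t)` is an a.e. limit of the measurable maps `ω ↦ f̂_t(i/n)`; on the a.s. event of
generation `sleTrace κ ω` *is* this curve (`Loewner.IsGeneratedByCurve.unique`). This is the
minimal measurability input of `exists_isSLECurve_of_aemeasurable`; it also follows from the
(stronger) named fact `identDistrib_sleTrace_scale` (`aemeasurable_sleTrace_of_identDistrib`).
[cite: RohdeSchramm2005, §3 p. 896 and Thm 5.1] -/
def aemeasurable_sleTrace : Prop :=
  ∀ {κ : ℝ≥0}, HasSLETrace κ → ∀ t : ℝ≥0, AEMeasurable (fun ω ↦ sleTrace κ ω t) Process.preWienerMeasure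

/-- `aemeasurable_sleTrace` follows from SLE scaling in law (`identDistrib_sleTrace_scale`),
which asserts in particular that the whole trace is an a.e.-measurable random path.
Lawler (2005), Prop. 6.5; Rohde–Schramm (2005), §3 p. 896. [cite: RohdeSchramm2005, §3 p. 896] -/
theorem aemeasurable_sleTrace_of_identDistrib (h₅ : identDistrib_sleTrace_scale) :
    aemeasurable_sleTrace :=
  fun {κ} _ t ↦ aemeasurable_sleTrace_apply_of_identDistrib h₅ κ t

/-- **Existence of chordal SLE_κ in a Dobrushin domain** (`Literature.Probability.RandomPlanarGeometry.exists_isSLECurve`) from the six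
named facts `hasSLETrace_eight` (LSW04 Thm 4.7), `hasSLETrace_of_ne_eight` (RS05 Thm 5.1),
`tendsto_norm_sleTrace_atTop` (RS05 Thm 7.1), `MarkedDomain.exists_isChordalUniformizing`
(Riemann mapping + Carathéodory), `JordanDomain.continuousOn_boundaryExtension` (Pommerenke
(1992), Thm 2.6) and `aemeasurable_sleTrace` (RS05 §3); all the glue is
`exists_isSLECurve_of_aemeasurable`. Lawler (2005), §6.3; Rohde–Schramm (2005), Thm 5.1 and
Thm 7.1. [cite: RohdeSchramm2005, Thm 5.1 and Thm 7.1] -/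
theorem exists_isSLECurve_of_aemeasurable_sleTrace (h8 : hasSLETrace_eight)
    (hne : hasSLETrace_of_ne_eight) (htr : tendsto_norm_sleTrace_atTop)
    (hunif : MarkedDomain.exists_isChordalUniformizing)
    (hext : JordanDomain.continuousOn_boundaryExtension) (hmeas : aemeasurable_sleTrace) :
    exists_isSLECurve :=
  exists_isSLECurve_of_aemeasurable h8 hne htr hunif hext hmeas

/-! ### The reduction to the printed disc-form theorems -/

/-- **Existence of chordal SLE_κ in a Dobrushin domain, reduced to the printed theorems.**
`Literature.Probability.RandomPlanarGeometry.exists_isSLECurve` follows from: SLE_κ is generated by a curve (`hasSLETrace_eight`,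
Lawler–Schramm–Werner 2004, Thm 4.7; `hasSLETrace_of_ne_eight`, Rohde–Schramm 2005, Thm 5.1),
transience of the trace (`tendsto_norm_sleTrace_atTop`, RS05 Thm 7.1), simple connectivity of
Jordan domains (`hsc`, Jordan–Schoenflies), the Riemann mapping theorem in disc form (`hRM`,
Ahlfors (1979), Ch. 6 §1.1, Thm 1), Carathéodory's theorem in disc form (`hC`, Pommerenke (1992),
Thm 2.6) and marginal measurability of the trace (`aemeasurable_sleTrace`, RS05 §3 p. 896): the
chordal uniformizing map comes from `MarkedDomain.exists_isChordalUniformizing_of_disc` and the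
continuity of its boundary extension from `JordanDomain.continuousOn_boundaryExtension_of_disc`.
Lawler (2005), §6.3; Rohde–Schramm (2005), Thm 5.1 and Thm 7.1. [cite: RohdeSchramm2005, Thm 5.1 and Thm 7.1] -/
theorem exists_isSLECurve_of_disc_facts (h8 : hasSLETrace_eight) (hne : hasSLETrace_of_ne_eight)
    (htr : tendsto_norm_sleTrace_atTop) (hsc : ∀ D : JordanDomain, D.isSimplyConnected)
    (hRM : ∀ {U : Set ℂ}, exists_conformalEquiv_ball (U := U))
    (hC : JordanDomain.exists_continuousOn_extension) (hmeas : aemeasurable_sleTrace) :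
    exists_isSLECurve :=
  exists_isSLECurve_of_aemeasurable_sleTrace h8 hne htr
    (MarkedDomain.exists_isChordalUniformizing_of_disc hsc hRM hC)
    (JordanDomain.continuousOn_boundaryExtension_of_disc hC) hmeas

/-- **Existence of chordal SLE_κ in Dobrushin domains from the trace theorems and Carathéodory's
theorem alone.** Compared with `exists_isSLECurve_of_disc_facts`, the two function-theoretic
hypotheses are now theorems of the tree: simple connectivity of Jordan domains
(`JordanDomain.isSimplyConnected_holds`, via Runge's theorem and Conway VIII.2.2 in
`Literature.Analysis.Complex.SimplyConnectedOfCompl`) and the Riemann mapping theorem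
(`exists_conformalEquiv_ball_holds`, `Literature.Analysis.Complex.RiemannMapping`). What remains
are the four SLE trace facts — `hasSLETrace_eight` (Lawler–Schramm–Werner 2004, Thm 4.7),
`hasSLETrace_of_ne_eight` (Rohde–Schramm 2005, Thm 5.1), `tendsto_norm_sleTrace_atTop`
(RS05 Thm 7.1), `aemeasurable_sleTrace` (RS05 §3) — and Carathéodory's theorem for Jordan
domains in disc form (`JordanDomain.exists_continuousOn_extension`, Pommerenke (1992) Thm 2.6).
Rohde–Schramm, Ann. Math. 161 (2005), Thm 5.1 and Thm 7.1. [cite: RohdeSchramm2005, Thm 5.1 and Thm 7.1] -/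
theorem exists_isSLECurve_of_trace_facts (h8 : hasSLETrace_eight) (hne : hasSLETrace_of_ne_eight)
    (htr : tendsto_norm_sleTrace_atTop) (hC : JordanDomain.exists_continuousOn_extension)
    (hmeas : aemeasurable_sleTrace) : exists_isSLECurve :=
  exists_isSLECurve_of_disc_facts h8 hne htr JordanDomain.isSimplyConnected_holds
    exists_conformalEquiv_ball_holds hC hmeas

/-- **Existence of chordal SLE_κ in Dobrushin domains from the trace theorems and Carathéodory's
continuity theorem.** As `exists_isSLECurve_of_trace_facts`, but with Carathéodory's theorem
weakened to its continuity part `JordanDomain.exists_continuousOn_closedBall_extension`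
(Pommerenke (1992), Thm 2.1, (ii) ⇒ (i): the Riemann map onto a Jordan domain extends
continuously to the closed disc — no injectivity on the circle, hence no Jordan curve theorem, is
needed: a continuous extension automatically maps the circle onto `∂D`,
`JordanDomain.surjOn_frontier_of_extension`). After this theorem `Literature.Probability.RandomPlanarGeometry.exists_isSLECurve` rests
on exactly: LSW04 Thm 4.7 (`κ = 8`), RS05 Thm 5.1 (`κ ≠ 8`), RS05 Thm 7.1 (transience), RS05 §3
(measurability of the trace marginals) and Pommerenke Thm 2.1. Rohde–Schramm, Ann. Math. 161
(2005), Thm 5.1 and Thm 7.1. [cite: RohdeSchramm2005, Thm 5.1 and Thm 7.1] -/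
theorem exists_isSLECurve_of_closedBall_facts (h8 : hasSLETrace_eight)
    (hne : hasSLETrace_of_ne_eight) (htr : tendsto_norm_sleTrace_atTop)
    (hC : JordanDomain.exists_continuousOn_closedBall_extension) (hmeas : aemeasurable_sleTrace) :
    exists_isSLECurve :=
  exists_isSLECurve_of_aemeasurable_sleTrace h8 hne htr
    (MarkedDomain.exists_isChordalUniformizing_of_closedBall JordanDomain.isSimplyConnected_holds
      exists_conformalEquiv_ball_holds hC)
    (JordanDomain.continuousOn_boundaryExtension_of_closedBall hC) hmeas

end Literature.Probability.RandomPlanarGeometry
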